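import Summits.QuantumFields.YangMills.Theorems.AlphaInputsT3ACv3AdaptedClass
import Literature.MathematicalPhysics.QuantumFieldTheory.Balaban1983to89.T3Thm1Carrier
import HarnessLib

/-!
# `AlphaInputsT3ACv3RegionalThm1Carrier` — B1 OF NODE O d = 3: [Balaban1985Variational] THEOREM 1's CARRIER AT ITS NATIVE, REGIONAL GENERALITY FOR THE T³∕AC LETTERS
# — the variational problem (2)–(8) of a HISTORY `h` (regions `Ω_j(h)`, data regions `Λ_j(h)`, multi-level data) as an LQB `B11.VarProblemX`, and the family
# `famRegT3 L`; the 19200 torus carrier `T3Thm1Carrier.varProblem3`∕`famX` is its trivial-history sub-family — cell `ym3-torus`, crux stmt-QuantumFields-19936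
# (`HistoryTailL`, (O″χ) block B1; ★★OWNER RULING g26-№8 (4)), LEAD seat `ym-ust-19936-w1` (g3)

WHY.  `HistoryTailL` reads BY NAME `⟨T8⟩ ∧ ⟨(O″χ)⟩`; the selection display (`…DataSchemaSelChi.InClassSelT3X`) asks the NODE O supplier to HAND a measurable in-class
selection, and the only one print supplies expansion data for is PRINT'S (42)-minimiser.  Print's Theorem 1 (p.277 (1), p.278 (2)(3)(7), p.279 (8)) is stated for
«a sequence of domains `Ω_j ⊂ T_η`, `j = 0,…,k`» with the multi-level constraint (3) «`Ūʲ = V` on `Λ_j`» — EXACTLY [Balaban1985UV3] (42)'s regional problem; the 19200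
carrier `varProblem3 F n K` is the one-region member.  So B1 («print's minimiser ∈ 𝒞_X») = LQB's `B11Thm1.Thm1At`∕`B11.Prop8Printed` at `famRegT3` + plumbing
rows (LEAD memo `B1-REGIONAL-THM1-LOCATE-w1-g3.md`, 19936 evidence #57; ★alpha-2 g7's answers Q1–Q3).
WHAT (definitions + unfoldings; NO estimate asserted).  §1 generic letters over an averaging family `av`: `bondsOn j X` (print's convention «at least one end-point in
`X`», p.277), the multi-level constraint (3) `ConstraintOn`, the group (4) `TrivialOn`, the CROSS-BOUNDARY datum `mixedDatum`∕`datumAt` (p.278: a level-`j` bond with no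
end-point in `Λ_j` carries the one-step average `V̄_b` of the level-`(j−1)` datum) and (7) `Reg7On` for the level-`j` plaquettes touching `Λ_j` and (below the top) avoiding
`Ω_{j+1}` — print's (7) covers interior and OUTWARD-straddling plaquettes.  §2 the T³ instance for `h : Hist (F.P K) k` over the lane's `Ω_j(h) = Carriers.Omega …`,
`Λ_j(h) = lam42 Ω(h) k j`: `RegOnT3` := LQB's `B10Eq68TorusRegularity.InSpace k Ω(h) e L^{−k}` (BOTH clauses of (2), through `SU(2) ≤ U(2)` as in
`T3PrintedRegularMinimiser.regPr_iff_inSpace`), `regFibreRegT3` := (2) ∩ (3) in the route's `blockAvg ℰp` currency, `varProblemRegT3 … k h : VarProblemX` (readings R1∕R2 of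
`varProblem3` verbatim over the regional regular fibre; (9)–(10) slots trivialised), `IdxReg L`, `famRegT3 L`.  §3 unfoldings, `top42Set_of_constraintOn`, and THE
TRIVIAL-HISTORY MEMBER IS THE TORUS PROBLEM: `regOnT3_triv_iff_regPr` (⟺ `RegPr F (K−k) K e`), `constraintOn_triv_iff`, `reg7On_triv_iff` (⟺ `PlaqSmall ε₁ (𝓥 k)`),
`trivialOn_triv_iff` — pin-at-triv compares like with like (the lattice identification `GaugeField (F.P K) k ≃ GaugeField (F.P (K−k)) 0` is the lane's `fieldShift`).
DIVERGENCES (recorded): D-reg-1 (3) in `blockAvg ℰp` currency (print∕LQB `Constraint42`: comb `avgT`; RULING g25-№3); D-reg-2 (9)–(10) not modelled (`Thm1At` here = print's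
Thm 1 MINUS (9)–(10)); D-reg-3 (7) at inner interfaces `∂Ω_{j+1}` is no hypothesis (print handles them by the extension (11)); D-reg-4 the frozen data `𝓥 j`, `j < k`, are a free
argument (the lane's `UkH k h W` integrates them out; B1 is stated for EVERY admissible measurable frozen selection — Q1; their ζ∕χ admissibility rows belong to the EDGES file).
HONEST FRAMING.  Bookkeeping of print's problem; no estimate of [B10]∕[B11] asserted; Theorem 1 at `famRegT3` is NOT proved (19200's H∕EX content at more members + the
regional Green's layer = NODE O B0); the stub 2′χ, the crux and any gap are NOT claimed; count-neutral helper (`--supports stmt-QuantumFields-19936`); registry untouched.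
YM₃ on the three-torus is rung R3 of the programme, NOT the Clay problem: nothing here bears on d = 4, infinite volume, or a mass gap.

References: T. Bałaban, Commun. Math. Phys. 102 (1985) 277–309 [Balaban1985Variational] ((1) p.277, (2)–(7) p.278, Thm 1 (8) p.279, (11) p.279); Commun. Math. Phys.
102 (1985) 255–275 [Balaban1985UV3] ((38)–(42) p.266, (67)–(68) p.273); Commun. Math. Phys. 99 (1985) 75–102 [Balaban1985RegularSpaces] ((1.7), (1.9) p.77); Commun.
Math. Phys. 98 (1985) 17–51 [Balaban1985Averaging] ((8) p.19, p.24).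
-/

set_option autoImplicit false

noncomputable section

/-! ## §1 Generic letters: print's bond convention, the multi-level constraint (3), the group (4), the cross-boundary datum and (7) -/

namespace Summit.QuantumFields.YangMills.Theorems.RegionalVP

open Set
open Literature.MathematicalPhysics.QuantumFieldTheory.Balaban1983to89
open Literature.MathematicalPhysics.QuantumFieldTheory.Balaban1983to89.B10Eq38TorusDomains (toFine cornerSet)

variable {P : Params} {G : Type*} [GaugeGroup G]

/-- **PRINT'S BOND CONVENTION** «we identify domains with sets of bonds … with at least one end-point belonging to Ω_j» (p.277): the bonds of `T^{(j)}` with an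
end-point (read in the fine torus through `toFine`) in the region `X`.  Contains LQB's both-end-points set `bondsIn j X`. [cite: Balaban1985Variational, (1) p.277] -/
def bondsOn (j : ℕ) (X : Set (Site P 0)) : Set (PBond P j) :=
  {b | toFine j b.src ∈ X ∨ toFine j (b.src.shift b.dir) ∈ X}

/-- Membership in `bondsOn`. [cite: Balaban1985Variational, (1) p.277] -/
theorem mem_bondsOn_iff {j : ℕ} {X : Set (Site P 0)} {b : PBond P j} :
    b ∈ bondsOn j X ↔ toFine j b.src ∈ X ∨ toFine j (b.src.shift b.dir) ∈ X := Iff.rfl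

/-- `bondsIn j X ⊆ bondsOn j X` (both end-points in `X` ⇒ some end-point in `X`). [cite: Balaban1985Variational, (3) p.278] -/
theorem bondsIn_subset_bondsOn (j : ℕ) (X : Set (Site P 0)) : B10Eq42TorusConstraint.bondsIn j X ⊆ bondsOn j X :=
  fun _ hb => Or.inl hb.1

/-- Every bond lies on the whole torus. [folklore] -/
theorem bondsOn_univ (j : ℕ) : bondsOn j (univ : Set (Site P 0)) = (univ : Set (PBond P j)) :=
  eq_univ_of_forall fun _ => Or.inl (mem_univ _)

/-- No bond lies on the empty region. [folklore] -/
theorem bondsOn_empty (j : ℕ) : bondsOn j (∅ : Set (Site P 0)) = (∅ : Set (PBond P j)) :=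
  eq_empty_of_forall_notMem fun _ hb => hb.elim id id

/-- **THE MULTI-LEVEL CONSTRAINT (3) «`Ūʲ = V` on `Λ_j`, `j = 0, 1, …, k`»** for an averaging family `av` (the route's is `blockAvg ℰp`), data regions `Λ j` and
MULTI-LEVEL data `𝓥` (`𝓥 j` is read on the bonds of `T^{(j)}` lying on `Λ j` only; levels `> k` unused): the `j`-fold average of `U` equals `𝓥 j` there.
[cite: Balaban1985Variational, (3) p.278; Balaban1985UV3, (42) p.266] -/
def ConstraintOn (av : ∀ j, Averaging P j G) (k : ℕ) (Λ : ℕ → Set (Site P 0)) (𝓥 : (j : ℕ) → GaugeField P j G) (U : GaugeField P 0 G) : Prop :=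
  ∀ j, j ≤ k → ∀ b : PBond P j, b ∈ bondsOn j (Λ j) → Averaging.iter av j U b = 𝓥 j b

/-- **PRINT'S GROUP (4) «`u(y) = 1` for `y ∈ 𝔅_k`»**: the fine gauge transformation is trivial at BOTH anchors `toFine j b₋`, `toFine j b₊` of every constrained bond
(the anchors at which an averaging family's covariance `Averaging.covariant` reads `u`), for every level `j ≤ k`. [cite: Balaban1985Variational, (4) p.278] -/
def TrivialOn (k : ℕ) (Λ : ℕ → Set (Site P 0)) (u : GaugeTransf P 0 G) : Prop :=
  ∀ j, j ≤ k → ∀ b : PBond P j, b ∈ bondsOn j (Λ j) → u (toFine j b.src) = 1 ∧ u (toFine j (b.src.shift b.dir)) = 1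

/-- The identity transformation lies in the group (4). [cite: Balaban1985Variational, (4) p.278] -/
theorem trivialOn_one (k : ℕ) (Λ : ℕ → Set (Site P 0)) : TrivialOn k Λ (fun _ => (1 : G)) :=
  fun _ _ _ _ => ⟨rfl, rfl⟩

open Classical in
/-- **THE CROSS-BOUNDARY DATUM OF LEVEL `j+1`** (p.278 «if `p′` intersects the boundary of `Λ_j` then some bonds `b` do not belong to `Λ_j` and we replace `V_b` by `V̄_b`»):
on the bonds of `T^{(j+1)}` lying on `Λ_{j+1}` the level-`(j+1)` datum, on the others the ONE-STEP AVERAGE of the level-`j` datum. [cite: Balaban1985Variational, (7) p.278] -/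
def mixedDatum (av : ∀ j, Averaging P j G) (Λsucc : Set (Site P 0)) (j : ℕ) (𝓥 : (j : ℕ) → GaugeField P j G) : GaugeField P (j + 1) G :=
  fun b => if b ∈ bondsOn (j + 1) Λsucc then 𝓥 (j + 1) b else (av j).avg (𝓥 j) b

/-- **THE DATUM READ BY (7) AT LEVEL `j`**: at level `0` the level-`0` datum itself (no finer data; `Ω₀ = T_η`), at level `j+1` the cross-boundary datum.
[cite: Balaban1985Variational, (7) p.278] -/
def datumAt (av : ∀ j, Averaging P j G) (Λ : ℕ → Set (Site P 0)) (𝓥 : (j : ℕ) → GaugeField P j G) : (j : ℕ) → GaugeField P j G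
  | 0 => 𝓥 0
  | j + 1 => mixedDatum av (Λ (j + 1)) j 𝓥

open Classical in
/-- On a bond lying on `Λ_{j+1}` the cross-boundary datum is the datum. [cite: Balaban1985Variational, (7) p.278] -/
theorem mixedDatum_of_mem {av : ∀ j, Averaging P j G} {Λsucc : Set (Site P 0)} {j : ℕ} {𝓥 : (j : ℕ) → GaugeField P j G} {b : PBond P (j + 1)}
    (hb : b ∈ bondsOn (j + 1) Λsucc) : mixedDatum av Λsucc j 𝓥 b = 𝓥 (j + 1) b := by
  unfold mixedDatum
  rw [if_pos hb]

open Classical in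
/-- Off `Λ_{j+1}` the cross-boundary datum is the one-step average of the finer datum. [cite: Balaban1985Variational, (7) p.278] -/
theorem mixedDatum_of_not_mem {av : ∀ j, Averaging P j G} {Λsucc : Set (Site P 0)} {j : ℕ} {𝓥 : (j : ℕ) → GaugeField P j G} {b : PBond P (j + 1)}
    (hb : b ∉ bondsOn (j + 1) Λsucc) : mixedDatum av Λsucc j 𝓥 b = (av j).avg (𝓥 j) b := by
  unfold mixedDatum
  rw [if_neg hb]

/-- On the whole torus the cross-boundary datum is the datum. [folklore] -/
theorem mixedDatum_univ (av : ∀ j, Averaging P j G) (j : ℕ) (𝓥 : (j : ℕ) → GaugeField P j G) : mixedDatum av univ j 𝓥 = 𝓥 (j + 1) := by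
  funext b
  exact mixedDatum_of_mem (by rw [bondsOn_univ]; exact mem_univ _)

/-- `datumAt … j = 𝓥 j` whenever `Λ j` is the whole torus (and always at level `0`). [folklore] -/
theorem datumAt_of_univ (av : ∀ j, Averaging P j G) (Λ : ℕ → Set (Site P 0)) (𝓥 : (j : ℕ) → GaugeField P j G) :
    ∀ j, (j = 0 ∨ Λ j = univ) → datumAt av Λ 𝓥 j = 𝓥 j
  | 0, _ => rfl
  | j + 1, h => by
    rcases h with h | h
    · exact absurd h (Nat.succ_ne_zero j)
    · show mixedDatum av (Λ (j + 1)) j 𝓥 = 𝓥 (j + 1)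
      rw [h, mixedDatum_univ]

/-- The flat multi-level datum reads flat through the cross-boundary datum, for an averaging family fixing `1`. [folklore] -/
theorem datumAt_one (av : ∀ j, Averaging P j G) (Λ : ℕ → Set (Site P 0)) (hav : ∀ j, (av j).avg 1 = 1) :
    ∀ j, datumAt av Λ (fun i => (1 : GaugeField P i G)) j = 1
  | 0 => rfl
  | j + 1 => by
    funext b
    show mixedDatum av (Λ (j + 1)) j (fun i => (1 : GaugeField P i G)) b = 1
    by_cases hb : b ∈ bondsOn (j + 1) (Λ (j + 1))
    · rw [mixedDatum_of_mem hb]; rfl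
    · rw [mixedDatum_of_not_mem hb, hav j]; rfl

/-- **(7) FOR THE MULTI-LEVEL DATUM, PRINT'S READING** (p.278): for every level `j ≤ k` and every plaquette `p′` of `T^{(j)}` with a corner in `Λ_j` and — below the top
level — NO corner in `Ω_{j+1}` (interior and OUTWARD-straddling plaquettes; D-reg-3), `|∂V(p′) − 1| < ε₁` with `∂V` read through the cross-boundary datum.
[cite: Balaban1985Variational, (7) p.278] -/
def Reg7On (av : ∀ j, Averaging P j G) (k : ℕ) (Ω Λ : ℕ → Set (Site P 0)) (ε₁ : ℝ) (𝓥 : (j : ℕ) → GaugeField P j G) : Prop :=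
  ∀ j, j ≤ k → ∀ p : Plaq P j, (cornerSet j p ∩ Λ j).Nonempty → (j < k → cornerSet j p ∩ Ω (j + 1) = ∅) →
    GaugeGroup.dist1 (GaugeField.plaqHol (datumAt av Λ 𝓥 j) p) < ε₁

/-- Unfolding `Reg7On` at one plaquette. [cite: Balaban1985Variational, (7) p.278] -/
theorem Reg7On.lt {av : ∀ j, Averaging P j G} {k : ℕ} {Ω Λ : ℕ → Set (Site P 0)} {ε₁ : ℝ} {𝓥 : (j : ℕ) → GaugeField P j G}
    (h : Reg7On av k Ω Λ ε₁ 𝓥) {j : ℕ} (hj : j ≤ k) {p : Plaq P j} (h₁ : (cornerSet j p ∩ Λ j).Nonempty)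
    (h₂ : j < k → cornerSet j p ∩ Ω (j + 1) = ∅) : GaugeGroup.dist1 (GaugeField.plaqHol (datumAt av Λ 𝓥 j) p) < ε₁ :=
  h j hj p h₁ h₂

/-- **THE TORUS CASE OF (3)**: with `Λ_j = ∅` below the top level and `Λ_k` the whole torus, the multi-level constraint is the top constraint on EVERY bond.
[cite: Balaban1985Variational, (3) p.278] -/
theorem constraintOn_iff_top {av : ∀ j, Averaging P j G} {k : ℕ} {Λ : ℕ → Set (Site P 0)} (hlow : ∀ j, j < k → Λ j = ∅) (htop : Λ k = univ)
    (𝓥 : (j : ℕ) → GaugeField P j G) (U : GaugeField P 0 G) :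
    ConstraintOn av k Λ 𝓥 U ↔ ∀ b : PBond P k, Averaging.iter av k U b = 𝓥 k b := by
  constructor
  · intro h b
    exact h k le_rfl b (by rw [htop, bondsOn_univ]; exact mem_univ _)
  · intro h j hj b hb
    rcases hj.lt_or_eq with hlt | rfl
    · rw [hlow j hlt, bondsOn_empty] at hb
      exact absurd hb (notMem_empty _)
    · exact h b

/-- **THE TORUS CASE OF (4)**: with `Λ_j = ∅` below the top level and `Λ_k` the whole torus, (4) says `u = 1` at every anchor `toFine k y`. [cite: Balaban1985Variational, (4) p.278] -/
theorem trivialOn_iff_top {k : ℕ} {Λ : ℕ → Set (Site P 0)} (hlow : ∀ j, j < k → Λ j = ∅) (htop : Λ k = univ) (u : GaugeTransf P 0 G) :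
    TrivialOn k Λ u ↔ ∀ b : PBond P k, u (toFine k b.src) = 1 ∧ u (toFine k (b.src.shift b.dir)) = 1 := by
  constructor
  · intro h b
    exact h k le_rfl b (by rw [htop, bondsOn_univ]; exact mem_univ _)
  · intro h j hj b hb
    rcases hj.lt_or_eq with hlt | rfl
    · rw [hlow j hlt, bondsOn_empty] at hb
      exact absurd hb (notMem_empty _)
    · exact h b

/-- **THE TORUS CASE OF (7)**: with `Λ_j = ∅` below the top level and `Λ_k = Ω_j` the whole torus, (7) is `PlaqSmall ε₁ (𝓥 k)` — the 19200 carrier's `Reg7`.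
[cite: Balaban1985Variational, (7) p.278] -/
theorem reg7On_iff_top {av : ∀ j, Averaging P j G} {k : ℕ} {Ω Λ : ℕ → Set (Site P 0)} (hlow : ∀ j, j < k → Λ j = ∅) (htop : Λ k = univ)
    (ε₁ : ℝ) (𝓥 : (j : ℕ) → GaugeField P j G) : Reg7On av k Ω Λ ε₁ 𝓥 ↔ PlaqSmall ε₁ (𝓥 k) := by
  have hk : datumAt av Λ 𝓥 k = 𝓥 k := datumAt_of_univ av Λ 𝓥 k (Or.inr htop)
  constructor
  · intro h p
    have hne : (cornerSet k p ∩ Λ k).Nonempty := by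
      rw [htop, inter_univ]
      exact ⟨toFine k p.src, by simp [cornerSet]⟩
    have := h k le_rfl p hne (fun hlt => absurd hlt (lt_irrefl k))
    rwa [hk] at this
  · intro h j hj p h₁ _
    rcases hj.lt_or_eq with hlt | rfl
    · rw [hlow j hlt, inter_empty] at h₁
      exact absurd h₁ not_nonempty_empty
    · rw [hk]
      exact h p

end Summit.QuantumFields.YangMills.Theorems.RegionalVP

/-! ## §2 The T³ instance: print's regional problem of a history, as an LQB `VarProblemX`, and the family `famRegT3` -/

namespace Summit.QuantumFields.YangMills.Theorems

open MeasureTheory Set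
open scoped Matrix.Norms.L2Operator
open Literature.MathematicalPhysics.QuantumFieldTheory.Balaban1983to89
open Literature.MathematicalPhysics.QuantumFieldTheory.Balaban1983to89.T3ContinuumYM3Torus
open Literature.MathematicalPhysics.QuantumFieldTheory.Balaban1983to89.T3UnitLawDensityEML (ℰp)
open Literature.MathematicalPhysics.QuantumFieldTheory.Balaban1983to89.T3PrintedRegularMinimiser (RegPr regPr_iff_inSpace)
open Literature.MathematicalPhysics.QuantumFieldTheory.Balaban1983to89.T3DescentFibreTower (avgFun_one expMeanLogSU_E_one plaqSmall_one)
open Literature.MathematicalPhysics.QuantumFieldTheory.Balaban1983to89.B10Eq27TorusAxialLog (toUField)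
open Literature.MathematicalPhysics.QuantumFieldTheory.Balaban1983to89.B10Eq68TorusRegularity (InSpace)
open Literature.MathematicalPhysics.QuantumFieldTheory.Balaban1983to89.B10Eq38TorusDomains (plaqsIn toFine cornerSet)
open Literature.MathematicalPhysics.QuantumFieldTheory.Balaban1983to89.B10Eq42TorusConstraint (bondsIn lam42 lam42_self lam42_of_lt)
open Literature.MathematicalPhysics.QuantumFieldTheory.Balaban1983to89.B11 (VarProblemX)
open Literature.MathematicalPhysics.QuantumFieldTheory.Balaban1985CMP102.Setting
open Summit.QuantumFields.Balaban3D.Carriers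
open Summit.QuantumFields.Balaban3D.Proofs.Primitives (AlphaConsts)
open Summit.QuantumFields.YangMills.Theorems.RegionalVP

section T3

variable (F : T3Family) (𝔠 : AlphaConsts F.L (suGroupModel 2).N) (γ : ℝ) (hγ : 0 < γ) (hγ1 : γ ≤ (min 𝔠.gamma0 1) ^ 2) (K : ℕ)

/-- **`U ∈ 𝔘_k({Ω_j(h)}, e)` — BOTH CLAUSES OF (2) OVER THE REGIONS OF THE HISTORY `h`**: LQB's `B10Eq68TorusRegularity.InSpace` at the lane's regions
`Ω_j(h)` (`Carriers.Omega`), radius `e`, `η = L^{−k}`, read through `SU(2) ≤ U(2)` — literally the right-hand side of `T3PrintedRegularMinimiser.regPr_iff_inSpace`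
with the whole torus replaced by `Ω_j(h)`. [cite: Balaban1985Variational, (2) p.278; Balaban1985RegularSpaces, (1.7), (1.9) p.77] -/
def AlphaInputsT3AC.RegOnT3 (k : ℕ) (h : Hist (F.P K) k) (e : ℝ) (U : GaugeField (F.P K) 0 (Matrix.specialUnitaryGroup (Fin 2) ℂ)) : Prop :=
  InSpace k (fun j => Omega 𝔠.lane.carrier.M₁ (rcolOf (T3Scales F γ hγ (hγ1.trans (sq_min_one_le _ 𝔠.gamma0_pos)) K) 𝔠.lane.carrier) k h j)
    e (((F.L : ℝ)⁻¹) ^ k) (toUField U)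

/-- **THE REGIONAL REGULAR FIBRE `𝔘_k({Ω_j(h)}, e) ∩ 𝔅_k(𝔅_k(h), 𝓥)`** — print's space (6)∕(8) of the history `h` at radius `e`: both clauses of (2) over the
`Ω_j(h)` and the multi-level constraint (3) over the `Λ_j(h) = lam42 Ω(h) k j` in the route's `blockAvg ℰp` currency (D-reg-1). [cite: Balaban1985Variational, (6) p.278, (8) p.279] -/
def AlphaInputsT3AC.regFibreRegT3 (k : ℕ) (h : Hist (F.P K) k) (e : ℝ)
    (𝓥 : (j : ℕ) → GaugeField (F.P K) j (Matrix.specialUnitaryGroup (Fin 2) ℂ)) : Set (GaugeField (F.P K) 0 (Matrix.specialUnitaryGroup (Fin 2) ℂ)) :=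
  {U | AlphaInputsT3AC.RegOnT3 F 𝔠 γ hγ hγ1 K k h e U ∧
    ConstraintOn (fun i => BlockAveraging.blockAvg (P := F.P K) (j := i) ℰp) k
      (lam42 (Omega 𝔠.lane.carrier.M₁ (rcolOf (T3Scales F γ hγ (hγ1.trans (sq_min_one_le _ 𝔠.gamma0_pos)) K) 𝔠.lane.carrier) k h) k) 𝓥 U}

/-- **PRINT'S GROUP (4) OF THE HISTORY `h`, AS AN ORBIT RELATION**: `U′ = U^u` for a fine gauge transformation trivial at the anchors of every constrained bond of
every `Λ_j(h)`. [cite: Balaban1985Variational, (4) p.278] -/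
def AlphaInputsT3AC.SameOrbitRegT3 (k : ℕ) (h : Hist (F.P K) k) (U U' : GaugeField (F.P K) 0 (Matrix.specialUnitaryGroup (Fin 2) ℂ)) : Prop :=
  ∃ u : GaugeTransf (F.P K) 0 (Matrix.specialUnitaryGroup (Fin 2) ℂ),
    TrivialOn k (lam42 (Omega 𝔠.lane.carrier.M₁ (rcolOf (T3Scales F γ hγ (hγ1.trans (sq_min_one_le _ 𝔠.gamma0_pos)) K) 𝔠.lane.carrier) k h) k) u ∧
      U' = GaugeField.gaugeAct u U

/-- **[Balaban1985Variational] THEOREM 1's CARRIER FOR THE REGIONAL PROBLEM OF A HISTORY** (`k ≤ K`, `h : Hist (F.P K) k`): `Cfg` = configurations on the finest lattice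
of run `K`; `Bdry` = MULTI-LEVEL data `𝓥 : (j : ℕ) → GaugeField (F.P K) j SU(2)` (`𝓥 k` the current datum on `Ω_k(h)`, `𝓥 j`, `j < k`, the frozen data on `Λ_j(h)`;
D-reg-4); (2) `InU := RegOnT3`; (3) `InB := ConstraintOn (blockAvg ℰp) k Λ(h)`; (7) `Reg7 := Reg7On (blockAvg ℰp) k Ω(h) Λ(h)`; «minimal orbit in `𝔘(e) ∩ 𝔅(𝓥)`» :=
reading R1 (global minimiser of the Wilson action over the regional regular fibre), `IsCritical` ∕ «unique critical orbit» := reading R2 — VERBATIM the readings of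
`T3Thm1Carrier.varProblem3` with `regFibrePr` ↦ `regFibreRegT3`; the (9)–(10) slots are trivialised (`Cube := Unit`, `Gauged := True`, norms `:= 0`; D-reg-2).
[cite: Balaban1985Variational, (2)–(8) pp.278–279] -/
def AlphaInputsT3AC.varProblemRegT3 (k : ℕ) (h : Hist (F.P K) k) : VarProblemX where
  Cfg := GaugeField (F.P K) 0 (Matrix.specialUnitaryGroup (Fin 2) ℂ)
  Bdry := (j : ℕ) → GaugeField (F.P K) j (Matrix.specialUnitaryGroup (Fin 2) ℂ)
  Cube := Unit
  scale := fun _ => k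
  sizeM := fun _ => 1
  eta := ((F.L : ℝ)⁻¹) ^ k
  L := F.L
  InU := fun e U => AlphaInputsT3AC.RegOnT3 F 𝔠 γ hγ hγ1 K k h e U
  InB := fun 𝓥 U => ConstraintOn (fun i => BlockAveraging.blockAvg (P := F.P K) (j := i) ℰp) k
    (lam42 (Omega 𝔠.lane.carrier.M₁ (rcolOf (T3Scales F γ hγ (hγ1.trans (sq_min_one_le _ 𝔠.gamma0_pos)) K) 𝔠.lane.carrier) k h) k) 𝓥 U
  Reg7 := fun ε₁ 𝓥 => Reg7On (fun i => BlockAveraging.blockAvg (P := F.P K) (j := i) ℰp) k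
    (Omega 𝔠.lane.carrier.M₁ (rcolOf (T3Scales F γ hγ (hγ1.trans (sq_min_one_le _ 𝔠.gamma0_pos)) K) 𝔠.lane.carrier) k h)
    (lam42 (Omega 𝔠.lane.carrier.M₁ (rcolOf (T3Scales F γ hγ (hγ1.trans (sq_min_one_le _ 𝔠.gamma0_pos)) K) 𝔠.lane.carrier) k h) k) ε₁ 𝓥
  OnMinimalOrbit := fun e 𝓥 U => U ∈ AlphaInputsT3AC.regFibreRegT3 F 𝔠 γ hγ hγ1 K k h e 𝓥 ∧
    IsMinOn (fun W : GaugeField (F.P K) 0 (Matrix.specialUnitaryGroup (Fin 2) ℂ) => wilsonAction4 W) (AlphaInputsT3AC.regFibreRegT3 F 𝔠 γ hγ hγ1 K k h e 𝓥) U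
  UniqueCriticalOrbit := fun ε₀ 𝓥 U => U ∈ AlphaInputsT3AC.regFibreRegT3 F 𝔠 γ hγ hγ1 K k h ε₀ 𝓥 ∧
    ∀ U' : GaugeField (F.P K) 0 (Matrix.specialUnitaryGroup (Fin 2) ℂ), U' ∈ AlphaInputsT3AC.regFibreRegT3 F 𝔠 γ hγ hγ1 K k h ε₀ 𝓥 →
      IsMinOn (fun W : GaugeField (F.P K) 0 (Matrix.specialUnitaryGroup (Fin 2) ℂ) => wilsonAction4 W) (AlphaInputsT3AC.regFibreRegT3 F 𝔠 γ hγ hγ1 K k h ε₀ 𝓥) U' →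
        AlphaInputsT3AC.SameOrbitRegT3 F 𝔠 γ hγ hγ1 K k h U U'
  Gauged := fun _ _ => True
  normA := fun _ _ => 0
  normGradA := fun _ _ => 0
  holderA := fun _ _ _ => 0
  normLapA := fun _ _ => 0
  IsCritical := fun 𝓥 U => ∃ e : ℝ, 0 < e ∧ U ∈ AlphaInputsT3AC.regFibreRegT3 F 𝔠 γ hγ hγ1 K k h e 𝓥 ∧
    IsMinOn (fun W : GaugeField (F.P K) 0 (Matrix.specialUnitaryGroup (Fin 2) ℂ) => wilsonAction4 W) (AlphaInputsT3AC.regFibreRegT3 F 𝔠 γ hγ hγ1 K k h e 𝓥) U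
  SameOrbit := AlphaInputsT3AC.SameOrbitRegT3 F 𝔠 γ hγ hγ1 K k h

end T3

/-- **THE INDEX OF THE REGIONAL FAMILY FOR ONE BLOCK SIZE `L`** («the constants a₀, a₁, B₃ depend on d and L only», p.279): a member `F` of the family with `F.L = L`, a
record `𝔠` over it, a coupling `γ` in the record's window, a run `K`, a step `k ≤ K` and an ADMISSIBLE history `h` of `k` steps (the regions are functions of these).
[cite: Balaban1985Variational, Thm 1 p.279] -/
def AlphaInputsT3AC.IdxReg (L : ℕ) : Type _ :=
  Σ (F : {F : T3Family // F.L = L}), Σ (𝔠 : AlphaConsts F.1.L (suGroupModel 2).N), Σ (γ : {γ : ℝ // 0 < γ ∧ γ ≤ (min 𝔠.gamma0 1) ^ 2}),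
    Σ (K : ℕ), Σ (k : {k : ℕ // k ≤ K}),
      {h : Hist (F.1.P K) k.1 // Hist.Admissible 𝔠.lane.carrier.M₁ (rcolOf (T3Scales F.1 γ.1 γ.2.1 (γ.2.2.trans (sq_min_one_le _ 𝔠.gamma0_pos)) K) 𝔠.lane.carrier) k.1 h}

/-- **THE REGIONAL FAMILY OF CARRIERS `famRegT3 L`** over `IdxReg L` — [Balaban1985Variational] Theorem 1's family at its native generality for the T³∕AC letters.
[cite: Balaban1985Variational, Thm 1 p.279] -/
def AlphaInputsT3AC.famRegT3 (L : ℕ) : AlphaInputsT3AC.IdxReg L → VarProblemX :=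
  fun i => AlphaInputsT3AC.varProblemRegT3 i.1.1 i.2.1 i.2.2.1.1 i.2.2.1.2.1 i.2.2.1.2.2 i.2.2.2.1 i.2.2.2.2.1.1 i.2.2.2.2.2.1

/-! ## §3 Unfoldings; (3) ⇒ the class's top constraint; the trivial-history member is the torus problem -/

section Facts

variable {F : T3Family} {𝔠 : AlphaConsts F.L (suGroupModel 2).N} {γ : ℝ} {hγ : 0 < γ} {hγ1 : γ ≤ (min 𝔠.gamma0 1) ^ 2} {K : ℕ}

/-- (2) at the regional carrier IS `RegOnT3`. [cite: Balaban1985Variational, (2) p.278] -/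
theorem AlphaInputsT3AC.varProblemRegT3_inU_iff {k : ℕ} (h : Hist (F.P K) k) (e : ℝ) (U : GaugeField (F.P K) 0 (Matrix.specialUnitaryGroup (Fin 2) ℂ)) :
    (AlphaInputsT3AC.varProblemRegT3 F 𝔠 γ hγ hγ1 K k h).InU e U ↔ AlphaInputsT3AC.RegOnT3 F 𝔠 γ hγ hγ1 K k h e U := Iff.rfl

/-- (3) at the regional carrier IS `ConstraintOn (blockAvg ℰp) k Λ(h)`. [cite: Balaban1985Variational, (3) p.278] -/
theorem AlphaInputsT3AC.varProblemRegT3_inB_iff {k : ℕ} (h : Hist (F.P K) k) (𝓥 : (j : ℕ) → GaugeField (F.P K) j (Matrix.specialUnitaryGroup (Fin 2) ℂ))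
    (U : GaugeField (F.P K) 0 (Matrix.specialUnitaryGroup (Fin 2) ℂ)) :
    (AlphaInputsT3AC.varProblemRegT3 F 𝔠 γ hγ hγ1 K k h).InB 𝓥 U ↔ ConstraintOn (fun i => BlockAveraging.blockAvg (P := F.P K) (j := i) ℰp) k
      (lam42 (Omega 𝔠.lane.carrier.M₁ (rcolOf (T3Scales F γ hγ (hγ1.trans (sq_min_one_le _ 𝔠.gamma0_pos)) K) 𝔠.lane.carrier) k h) k) 𝓥 U :=
  Iff.rfl

/-- «minimal orbit in `𝔘(e) ∩ 𝔅(𝓥)`» at the regional carrier (reading R1). [cite: Balaban1985Variational, Thm 1 (8) p.279] -/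
theorem AlphaInputsT3AC.varProblemRegT3_onMinimalOrbit_iff {k : ℕ} (h : Hist (F.P K) k) (e : ℝ)
    (𝓥 : (j : ℕ) → GaugeField (F.P K) j (Matrix.specialUnitaryGroup (Fin 2) ℂ)) (U : GaugeField (F.P K) 0 (Matrix.specialUnitaryGroup (Fin 2) ℂ)) :
    (AlphaInputsT3AC.varProblemRegT3 F 𝔠 γ hγ hγ1 K k h).OnMinimalOrbit e 𝓥 U ↔
      U ∈ AlphaInputsT3AC.regFibreRegT3 F 𝔠 γ hγ hγ1 K k h e 𝓥 ∧
        IsMinOn (fun W : GaugeField (F.P K) 0 (Matrix.specialUnitaryGroup (Fin 2) ℂ) => wilsonAction4 W) (AlphaInputsT3AC.regFibreRegT3 F 𝔠 γ hγ hγ1 K k h e 𝓥) U :=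
  Iff.rfl

/-- **(3) ⇒ THE CLASS'S TOP CONSTRAINT**: a configuration satisfying the multi-level constraint of the history `h` with data `𝓥` lies in `top42Set … k h (𝓥 k)` (`Λ_k(h) = Ω_k(h)`,
`bondsIn ⊆ bondsOn`) — the first conjunct of `𝒞_X`-membership B1 needs. [cite: Balaban1985UV3, (42) p.266; Balaban1985Variational, (3) p.278] -/
theorem AlphaInputsT3AC.top42Set_of_constraintOn {k : ℕ} {h : Hist (F.P K) k} {𝓥 : (j : ℕ) → GaugeField (F.P K) j (Matrix.specialUnitaryGroup (Fin 2) ℂ)}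
    {U : GaugeField (F.P K) 0 (Matrix.specialUnitaryGroup (Fin 2) ℂ)}
    (hU : ConstraintOn (fun i => BlockAveraging.blockAvg (P := F.P K) (j := i) ℰp) k
      (lam42 (Omega 𝔠.lane.carrier.M₁ (rcolOf (T3Scales F γ hγ (hγ1.trans (sq_min_one_le _ 𝔠.gamma0_pos)) K) 𝔠.lane.carrier) k h) k) 𝓥 U) :
    U ∈ AlphaInputsT3AC.top42Set F 𝔠 γ hγ hγ1 K k h (𝓥 k) := by
  intro b hb
  refine hU k le_rfl b ?_
  rw [lam42_self]
  exact bondsIn_subset_bondsOn k _ hb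

/-- The data regions of the TRIVIAL history: empty below the top level. [cite: Balaban1985UV3, (42) p.266, (47) p.267] -/
theorem AlphaInputsT3AC.lam42_triv_of_lt {k j : ℕ} (hj : j < k) :
    lam42 (Omega 𝔠.lane.carrier.M₁ (rcolOf (T3Scales F γ hγ (hγ1.trans (sq_min_one_le _ 𝔠.gamma0_pos)) K) 𝔠.lane.carrier) k (Hist.triv (F.P K) k)) k j
      = (∅ : Set (Site (F.P K) 0)) := by
  rw [lam42_of_lt hj, Omega_triv, Omega_triv]
  simp

/-- The data region of the TRIVIAL history at the top level: the whole torus. [cite: Balaban1985UV3, (42) p.266, (47) p.267] -/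
theorem AlphaInputsT3AC.lam42_triv_self (k : ℕ) :
    lam42 (Omega 𝔠.lane.carrier.M₁ (rcolOf (T3Scales F γ hγ (hγ1.trans (sq_min_one_le _ 𝔠.gamma0_pos)) K) 𝔠.lane.carrier) k (Hist.triv (F.P K) k)) k k
      = (univ : Set (Site (F.P K) 0)) := by
  rw [lam42_self, Omega_triv]

/-- **THE TRIVIAL-HISTORY MEMBER, CLAUSE (2): `RegOnT3 k triv e U` IS `RegPr F (K−k) K e U`** (`Ω_j(triv) = T_η` at every level, then the dictionary `regPr_iff_inSpace`).
[cite: Balaban1985Variational, (2) p.278] -/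
theorem AlphaInputsT3AC.regOnT3_triv_iff_regPr {k : ℕ} (hk : k ≤ K) {e : ℝ} (he : 0 ≤ e) (U : GaugeField (F.P K) 0 (Matrix.specialUnitaryGroup (Fin 2) ℂ)) :
    AlphaInputsT3AC.RegOnT3 F 𝔠 γ hγ hγ1 K k (Hist.triv (F.P K) k) e U ↔ RegPr F (K - k) K e U := by
  have hKk : K - (K - k) = k := Nat.sub_sub_self hk
  rw [regPr_iff_inSpace he U, hKk]
  unfold AlphaInputsT3AC.RegOnT3
  simp only [Omega_triv]

/-- **THE TRIVIAL-HISTORY MEMBER, CLAUSE (3): the multi-level constraint IS the top constraint on every bond of `T^{(k)}`.** [cite: Balaban1985Variational, (3) p.278] -/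
theorem AlphaInputsT3AC.constraintOn_triv_iff {k : ℕ} (𝓥 : (j : ℕ) → GaugeField (F.P K) j (Matrix.specialUnitaryGroup (Fin 2) ℂ))
    (U : GaugeField (F.P K) 0 (Matrix.specialUnitaryGroup (Fin 2) ℂ)) :
    ConstraintOn (fun i => BlockAveraging.blockAvg (P := F.P K) (j := i) ℰp) k
        (lam42 (Omega 𝔠.lane.carrier.M₁ (rcolOf (T3Scales F γ hγ (hγ1.trans (sq_min_one_le _ 𝔠.gamma0_pos)) K) 𝔠.lane.carrier) k (Hist.triv (F.P K) k)) k) 𝓥 U ↔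
      ∀ b : PBond (F.P K) k, Averaging.iter (fun i => BlockAveraging.blockAvg (P := F.P K) (j := i) ℰp) k U b = 𝓥 k b :=
  constraintOn_iff_top (fun _ hj => AlphaInputsT3AC.lam42_triv_of_lt (hγ := hγ) (hγ1 := hγ1) hj)
    (AlphaInputsT3AC.lam42_triv_self (hγ := hγ) (hγ1 := hγ1) (K := K) k) 𝓥 U

/-- **THE TRIVIAL-HISTORY MEMBER, CLAUSE (7): `Reg7` IS `PlaqSmall ε₁ (𝓥 k)`** — the 19200 carrier's `Reg7 := PlaqSmall ε₁ V` at the current datum.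
[cite: Balaban1985Variational, (7) p.278] -/
theorem AlphaInputsT3AC.reg7On_triv_iff {k : ℕ} (ε₁ : ℝ) (𝓥 : (j : ℕ) → GaugeField (F.P K) j (Matrix.specialUnitaryGroup (Fin 2) ℂ)) :
    Reg7On (fun i => BlockAveraging.blockAvg (P := F.P K) (j := i) ℰp) k
        (Omega 𝔠.lane.carrier.M₁ (rcolOf (T3Scales F γ hγ (hγ1.trans (sq_min_one_le _ 𝔠.gamma0_pos)) K) 𝔠.lane.carrier) k (Hist.triv (F.P K) k))
        (lam42 (Omega 𝔠.lane.carrier.M₁ (rcolOf (T3Scales F γ hγ (hγ1.trans (sq_min_one_le _ 𝔠.gamma0_pos)) K) 𝔠.lane.carrier) k (Hist.triv (F.P K) k)) k) ε₁ 𝓥 ↔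
      PlaqSmall ε₁ (𝓥 k) :=
  reg7On_iff_top (fun _ hj => AlphaInputsT3AC.lam42_triv_of_lt (hγ := hγ) (hγ1 := hγ1) hj)
    (AlphaInputsT3AC.lam42_triv_self (hγ := hγ) (hγ1 := hγ1) (K := K) k) ε₁ 𝓥

/-- **THE TRIVIAL-HISTORY MEMBER, GROUP (4): (4) IS «`u = 1` at every anchor of `T^{(k)}`»** — the fine-torus reading of the 19200 carrier's `descTransf … u = 1`.
[cite: Balaban1985Variational, (4) p.278] -/
theorem AlphaInputsT3AC.trivialOn_triv_iff {k : ℕ} (u : GaugeTransf (F.P K) 0 (Matrix.specialUnitaryGroup (Fin 2) ℂ)) :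
    TrivialOn k (lam42 (Omega 𝔠.lane.carrier.M₁ (rcolOf (T3Scales F γ hγ (hγ1.trans (sq_min_one_le _ 𝔠.gamma0_pos)) K) 𝔠.lane.carrier) k (Hist.triv (F.P K) k)) k) u ↔
      ∀ b : PBond (F.P K) k, u (toFine k b.src) = 1 ∧ u (toFine k (b.src.shift b.dir)) = 1 :=
  trivialOn_iff_top (fun _ hj => AlphaInputsT3AC.lam42_triv_of_lt (hγ := hγ) (hγ1 := hγ1) hj)
    (AlphaInputsT3AC.lam42_triv_self (hγ := hγ) (hγ1 := hγ1) (K := K) k) u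

/-- **NON-VACUITY OF THE (7) SLOT**: the flat multi-level datum satisfies (7) for every history (`ε₁ > 0`). [cite: Balaban1985Variational, (7) p.278] -/
theorem AlphaInputsT3AC.reg7On_one {k : ℕ} (h : Hist (F.P K) k) {ε₁ : ℝ} (hε₁ : 0 < ε₁) :
    (AlphaInputsT3AC.varProblemRegT3 F 𝔠 γ hγ hγ1 K k h).Reg7 ε₁ (fun j => (1 : GaugeField (F.P K) j (Matrix.specialUnitaryGroup (Fin 2) ℂ))) := by
  have hav : ∀ j, ((fun i => BlockAveraging.blockAvg (P := F.P K) (j := i)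
      (ℰp : LoopAverage (Matrix.specialUnitaryGroup (Fin 2) ℂ))) j).avg 1 = 1 := fun j => by
    show BlockAveraging.avgFun ℰp (1 : GaugeField (F.P K) j (Matrix.specialUnitaryGroup (Fin 2) ℂ)) = 1
    exact avgFun_one ℰp (fun n => expMeanLogSU_E_one n)
  intro j _ p _ _
  rw [datumAt_one _ _ hav j]
  exact plaqSmall_one hε₁ p

end Facts

end Summit.QuantumFields.YangMills.Theorems

end
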